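import Summits.FinalStateConjecture.FinalStateConjecture.Theorems.StarvedNecksHonestFixedRadiusSettlingStubRegionOneFarClosenessAux

/-!
# Route StarvedNecks — crux `HonestFixedRadiusSettling`, line `far-field-surgery` (reshape v6, sheet burial):
# stub `stub_regionOneFarCloseness` (honest clause Hf.3 of region I)

The registered stub `stub_regionOneFarCloseness` of the sheet-burial skeleton (lead c2), proved: for the hole
chart `Ψ y = holeMap M T₀ y` of the explicit `N = 1` decomposition of the Schwarzschild exterior
`Kerr.spacetime M 0 (2M)` over the background `boostedKerrBackground 1 0 M 0` (time `y⁰`, radius `‖ỹ‖`, form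
`g_{M,0}`), there is a time `T` such that the `C⁰` sup norm of the deviation `Ψ^* g − g_{M,0}` over the far
region `{y⁰ ≥ T, ‖ỹ‖ ≥ 100M}` is at most `1/10`.

Proof.  Take `T = max (T₀ + 2) T₁` with `T₁` the far time of `exists_farTime` (part 1,
`…StubRegionOneFarClosenessAux`).  At `k = 0` the sup norm is the pointwise operator norm
(`norm_iteratedFDeriv_zero`), bounded through `ContinuousLinearMap.opNorm_le_bound₂`.  On `{y⁰ > T₀ + 1}` the
hole map is the bent map `y ↦ y + β(y) e₀` (`holeMap_eventuallyEq_bentMap`), so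
`dΨ(v) = v + dβ(v) e₀` (`mfderiv_apply_of_rep`) and `Ψ y = y + β(y) e₀`; since `g_{M,0}` is stationary the
deviation is `a g(e₀, w) + b g(v, e₀) + a b g(e₀, e₀)` with `a = dβ(v)`, `b = dβ(w)`
(`kerr_bilin_timeShift_sub`), of size `≤ (2δ + δ²) ‖v‖ ‖w‖` once `|dβ(u)| ≤ δ ‖u‖` (`abs_timeShift_dev_le`;
`|g(e₀, ·)| ≤ ‖·‖` because `2M/r ≤ 1`).  Far out `δ = 1/55 + 1/49` works (`abs_fderiv_bendAt_le` and the
choice of `T₁`), and `2δ + δ² < 1/10`.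

No definitions, no named facts; standard axioms.

References: Misner–Thorne–Wheeler 1973, §31.4; Dafermos–Holzegel–Rodnianski–Taylor arXiv:2104.08222, §1
(pointwise norms of the metric deviation); O'Neill 1983, Ch. 13.
-/

set_option linter.dupNamespace false

noncomputable section

namespace Summit.FinalStateConjecture.FinalStateConjecture.Theorems.StarvedNecks.SheetBurial

open scoped Manifold ContDiff Topology RealInnerProductSpace
open Set Filter Function Literature.Geometry.Lorentzian
open Summit.FinalStateConjecture.FinalStateConjecture.Theorems.SwallowTheDatum.UniversalWitnessFamily

/-- **Stub 5 of the sheet burial — `stub_regionOneFarCloseness` (Hf.3: the bent hole chart is `C⁰`-close to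
Schwarzschild beyond `100M`, late).**  For the hole chart `Ψ y = holeMap M T₀ y` the `C⁰` sup norm of the
deviation `Ψ^* g − g_{M,0}` over `{y⁰ ≥ T, ‖ỹ‖ ≥ 100M}` is at most `1/10` for `T = max (T₀ + 2) T₁`. -/
theorem stub_regionOneFarCloseness :
    ∀ [Kerr.Facts] (M : ℝ) (hM : 0 < M) (T₀ : ℝ)
      (Ψ : (boostedKerrBackground 1 0 M 0).domain → Kerr.region 0 (Kerr.rPlus M 0)),
      (∀ y, (Ψ y : E4) = holeMap M T₀ y) →
      ∃ T : ℝ, supCkENorm (Subtype.val '' {x : (boostedKerrBackground 1 0 M 0).domain |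
          T ≤ (boostedKerrBackground 1 0 M 0).time x.1 ∧ 100 * M ≤ (boostedKerrBackground 1 0 M 0).radius x.1})
        0 ((Kerr.spacetime M 0 (Kerr.rPlus M 0) hM.le).deviationExtend (boostedKerrBackground 1 0 M 0) Ψ) ≤
        ENNReal.ofReal (1 / 10) := by
  intro _ M hM T₀ Ψ hΨ
  obtain ⟨C, hC0, hC⟩ := exists_bound_deriv_smoothTransition
  obtain ⟨T₁, hT₁0, hT₁⟩ := exists_farTime hM hC0
  refine ⟨max (T₀ + 2) T₁, iSup₂_le fun m hm ↦ iSup₂_le fun z hz ↦ ?_⟩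
  obtain ⟨x, hx, rfl⟩ := hz
  obtain rfl : m = 0 := Nat.le_zero.1 hm
  simp only [Set.mem_setOf_eq, holeBackground_time, holeBackground_radius, max_le_iff] at hx
  obtain ⟨⟨hxT₀, hxT₁⟩, hxr⟩ := hx
  rw [← ofReal_norm, norm_iteratedFDeriv_zero]
  refine ENNReal.ofReal_le_ofReal ?_
  rw [Spacetime.deviationExtend_coe]
  refine ContinuousLinearMap.opNorm_le_bound₂ _ (by norm_num) fun v w ↦ ?_
  rw [Spacetime.deviation_apply, holeBackground_bilin, Real.norm_eq_abs]
  -- facts about the point `x`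
  have hx2 : 2 * M < E4.spatialNorm x.1 := (mem_holeDomain hM.le).1 x.2
  have hx0 : E4.spatialNorm x.1 ≠ 0 := by linarith
  have hxt : 0 < x.1 0 := by linarith
  have hlt : T₀ + 1 < x.1 0 := by linarith
  have hdiff : DifferentiableAt ℝ (holeMap M T₀) x.1 :=
    (contDiffAt_holeMap hM T₀ hx2 (n := 1)).differentiableAt (by norm_num)
  have hfd : fderiv ℝ (holeMap M T₀) x.1 = fderiv ℝ (bentMap M) x.1 :=
    (holeMap_eventuallyEq_bentMap M hlt).fderiv_eq
  -- the differential of the bent map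
  have hβd : DifferentiableAt ℝ (fun z : E4 ↦ bend M (z 0) (E4.spatialNorm z)) x.1 :=
    (contDiffAt_bendAt hM hx2 (n := 1)).differentiableAt (by norm_num)
  have hbent : HasFDerivAt (bentMap M) (ContinuousLinearMap.id ℝ E4 +
      (fderiv ℝ (fun z : E4 ↦ bend M (z 0) (E4.spatialNorm z)) x.1).smulRight (E4.basisVector 0)) x.1 := by
    have : bentMap M = fun y ↦ y + bend M (y 0) (E4.spatialNorm y) • E4.basisVector 0 := rfl
    rw [this]
    exact (hasFDerivAt_id x.1).add (hβd.hasFDerivAt.smul_const (E4.basisVector 0))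
  have hDv : ∀ u : E4, fderiv ℝ (bentMap M) x.1 u =
      u + (fderiv ℝ (fun z : E4 ↦ bend M (z 0) (E4.spatialNorm z)) x.1 u) • E4.basisVector 0 := by
    intro u
    rw [hbent.fderiv]
    rfl
  -- the deviation in closed form (stationarity of `g_{M,0}`)
  have hval : (Kerr.smoothMetric M 0 (Kerr.rPlus M 0)).val (Ψ x) (mfderiv 𝓘(ℝ, E4) 𝓘(ℝ, E4) Ψ x v)
        (mfderiv 𝓘(ℝ, E4) 𝓘(ℝ, E4) Ψ x w) - Kerr.bilin M 0 x.1 v w =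
      fderiv ℝ (fun z : E4 ↦ bend M (z 0) (E4.spatialNorm z)) x.1 v *
          (-(w 0) + 2 * M / E4.spatialNorm x.1 * (w 0 + ⟪E4.spatial x.1, E4.spatial w⟫ / E4.spatialNorm x.1)) +
        fderiv ℝ (fun z : E4 ↦ bend M (z 0) (E4.spatialNorm z)) x.1 w *
          (-(v 0) + 2 * M / E4.spatialNorm x.1 * (v 0 + ⟪E4.spatial x.1, E4.spatial v⟫ / E4.spatialNorm x.1)) +
        fderiv ℝ (fun z : E4 ↦ bend M (z 0) (E4.spatialNorm z)) x.1 v *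
          fderiv ℝ (fun z : E4 ↦ bend M (z 0) (E4.spatialNorm z)) x.1 w * (-1 + 2 * M / E4.spatialNorm x.1) := by
    rw [Kerr.smoothMetric_val, hΨ x, mfderiv_apply_of_rep Ψ (holeMap M T₀) hΨ x hdiff,
      mfderiv_apply_of_rep Ψ (holeMap M T₀) hΨ x hdiff, hfd, hDv, hDv, holeMap_of_le M hlt.le, bentMap_eq]
    exact kerr_bilin_timeShift_sub hx0 _ _ _ v w
  change |(Kerr.smoothMetric M 0 (Kerr.rPlus M 0)).val (Ψ x) (mfderiv 𝓘(ℝ, E4) 𝓘(ℝ, E4) Ψ x v)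
      (mfderiv 𝓘(ℝ, E4) 𝓘(ℝ, E4) Ψ x w) - Kerr.bilin M 0 x.1 v w| ≤ 1 / 10 * ‖v‖ * ‖w‖
  rw [hval]
  -- the bounds
  have hδ : ∀ u : E4, |fderiv ℝ (fun z : E4 ↦ bend M (z 0) (E4.spatialNorm z)) x.1 u| ≤
      (1 / 55 + 1 / 49) * ‖u‖ := by
    intro u
    refine (abs_fderiv_bendAt_le hM hC hC0 hxr hxt u).trans (mul_le_mul_of_nonneg_right ?_ (norm_nonneg u))
    have := hT₁ (x.1 0) hxT₁
    linarith
  have hh0 : 0 ≤ 2 * M / E4.spatialNorm x.1 := div_nonneg (by linarith) (E4.spatialNorm_nonneg _)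
  have hh1 : 2 * M / E4.spatialNorm x.1 ≤ 1 := by rw [div_le_one (by linarith)]; linarith
  refine (abs_timeShift_dev_le hh0 hh1 (by norm_num : (0 : ℝ) ≤ 1 / 55 + 1 / 49) (norm_nonneg v)
    (norm_nonneg w) (C0Extension.abs_apply_zero_le_norm v) (C0Extension.abs_apply_zero_le_norm w)
    (abs_inner_spatial_div_le x.1 v)
    (abs_inner_spatial_div_le x.1 w) (hδ v) (hδ w)).trans ?_
  have hnum : 2 * (1 / 55 + 1 / 49) + (1 / 55 + 1 / 49) ^ 2 ≤ (1 / 10 : ℝ) := by norm_num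
  exact mul_le_mul_of_nonneg_right (mul_le_mul_of_nonneg_right hnum (norm_nonneg v)) (norm_nonneg w)

end Summit.FinalStateConjecture.FinalStateConjecture.Theorems.StarvedNecks.SheetBurial

end
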